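import Mathlib.Data.ZMod.Basic
import Mathlib.Algebra.BigOperators.Ring.Finset
import Mathlib.Algebra.Group.Subgroup.Finite
import Mathlib.GroupTheory.Coset.Card
import Mathlib.Data.Fintype.Pi
import Mathlib.Data.Finset.Pi
import Mathlib.Data.Fintype.BigOperators
import Mathlib.Tactic.Ring
import Mathlib.Tactic.Positivity
import Mathlib.Tactic.Abel
import Mathlib.Tactic.Linarith
import Literature.ModelTheory.FiniteModelTheory.XorLocalConsistency
import HarnessLib

/-!
# Closure and local distributions for expanding linear systems over `ℤ/p`

Topic `Literature/ModelTheory/FiniteModelTheory`; support file for the discharge of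
`LichterPago2025_cohomologyFooled` (`CohomologicalConsistencyLimits.lean`): the local-consistency
machinery for SPARSE LINEAR SYSTEMS OVER `ℤ/p` on a boundary expander, in the form that yields not only
`k`-local satisfiability (Duplicator strategies, as in `XorLocalConsistency.lean` for `p = 2`) but
CONSISTENT FAMILIES OF LOCAL DISTRIBUTIONS with `p`-power denominators ("`p`-solutions" of the
width-`k` relaxation in the sense of Berkholz–Grohe / Lichter–Pago).

A system is given by scopes `S : U → Finset V` and right-hand sides `b : U → ZMod p`; constraint `u`
reads `∑_{v ∈ S u} x_v = b u`.  Everything is relative to a radius `r` and the boundary-expansion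
hypothesis `q |T| ≤ e |∂T|` for `|T| ≤ r` (`∂T` = `XorSystem.boundary S T`, the variables lying in
exactly one scope of `T`; Ben-Sasson–Wigderson 2001, §5).

* `Adm S r W T` — `T` is `W`-ADMISSIBLE: `|T| ≤ r` and `∂T ⊆ W`.  Admissible sets are closed under
  union as long as `2e|W| ≤ qr` (`Adm.union`), so their union `cl S r W` (the CLOSURE of the variable
  set `W`, Alekhnovich–Razborov 2001, §3 / Ben-Sasson–Wigderson 2001, §5, in the union form) is the
  largest admissible set; `|cl W| ≤ e|W|/q`, `∂(cl W) ⊆ W`, `cl` is monotone, and every constraint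
  whose scope lies in `W` belongs to `cl W`.
* `exists_extend` — THE EXTENSION LEMMA: for `W ⊆ W'` with `2e|W'| ≤ qr`, every assignment satisfying
  the constraints of `cl W` agrees on `W` and on all variables of `cl W` with an assignment satisfying
  the constraints of `cl W'` (peeling: a non-empty `T ⊆ cl W'` disjoint from `cl W` has a constraint
  with a private variable outside `W` and outside the variables of `cl W`, for otherwise `T ∪ cl W`
  would be `W`-admissible).
* `Good S b r W h` — the partial assignment `h|W` is CONSISTENT: it is the restriction of a solution
  of the constraints of `cl W`.  Proved: monotone in `W`, depends only on `h|W`, the empty assignment is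
  good on an expander (`good_of_empty`), a good assignment satisfies every constraint with scope inside
  its domain (`Good.sum_eq`), and **good assignments extend** to any larger small domain
  (`Good.extend`).
* `imgSet S b r W h D` — the set of restrictions to the context `D` of the solutions of `cl (W ∪ D)`
  extending `h|W`; `locMeasure … D` — the uniform probability measure on it, as a function
  `(↥D → ZMod p) → ℚ`.  Proved (for good `h` and `2e|W ∪ D| ≤ qr`): total mass `1`
  (`sum_locMeasure`), support inside `imgSet` (whose members are good and extend `h`), the
  **compatibility under restriction of contexts** `D' ⊆ D` (`sum_locMeasure_restrict`: the push-forward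
  of `locMeasure D` to `D'` (along Mathlib's `Finset.restrict₂`) is `locMeasure D'` — image equality by the extension lemma, equal fibres by
  the affine structure of solution sets), and, for `p` prime, that all non-zero values equal one and the
  same `(p^j)⁻¹` with `j ≤ |D|` (`locMeasure_eq_inv_pow`: `imgSet` is a coset of a subgroup of
  `(↥D → ZMod p)`).  These are the consistent local distributions of Grigoriev 2001 / Schoenebeck 2008 /
  Benabbas–Georgiou–Magen–Tulsiani 2012 for expanding linear systems, here CONDITIONED on a good partial
  assignment `h`.

## References

* [BenSassonWigderson2001] E. Ben-Sasson, A. Wigderson, *Short proofs are narrow — resolution made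
  simple*, J. ACM 48 (2001), §5–6 (boundary expansion, closure, the peeling argument).
* [AlekhnovichRazborov2001] M. Alekhnovich, A. Razborov, *Lower bounds for polynomial calculus:
  non-binomial case*, FOCS 2001 (journal version Proc. Steklov Inst. 242 (2003)), §3 (closure operator
  of a set of variables w.r.t. an expander).
* D. Grigoriev, *Linear lower bound on degrees of Positivstellensatz calculus proofs for the parity*,
  Theoret. Comput. Sci. 259 (2001); G. Schoenebeck, *Linear level Lasserre lower bounds for certain
  k-CSPs*, FOCS 2008, Lemma 13; [BenabbasEtAl2012] S. Benabbas, K. Georgiou, A. Magen, M. Tulsiani,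
  *SDP gaps from pairwise independence*, Theory Comput. 8 (2012), §4.1 (consistent local distributions
  on expanding instances: closure and the extension property).
* [BerkholzGrohe2016] C. Berkholz, M. Grohe, *Linear Diophantine equations, group CSPs, and graph
  isomorphism*, SODA 2017 = arXiv:1607.04287 (`p`-solutions); [LichterPago2025] M. Lichter, B. Pago,
  arXiv:2407.09097, Def. 2.1, Lemma 2.2, Lemma 4.7, Cor. 4.13; [AtseriasDawar2019] A. Atserias, A. Dawar,
  arXiv:1806.11307, §3.2 (Lemma 3.5, Claims 3.6–3.7: the `p = 2` local-satisfiability statements).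
-/

namespace Literature.ModelTheory.FiniteModelTheory

open Finset

namespace LinSystem

variable {U V : Type*} [DecidableEq V] {p : ℕ}

/-! ### Satisfaction, admissible sets, closure -/

section Closure

variable (S : U → Finset V)

/-- The assignment `x` SATISFIES constraint `u` of the system `(S, b)`: `∑_{v ∈ S u} x v = b u`.
[cite: AtseriasDawar2019, §3.2 (the system Ax = b)] -/
def Sat (b : U → ZMod p) (x : V → ZMod p) (u : U) : Prop :=
  ∑ v ∈ S u, x v = b u

variable (r : ℕ)

/-- `T` is `W`-ADMISSIBLE at radius `r`: at most `r` constraints, all of whose boundary variables lie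
in `W`. [cite: BenSassonWigderson2001, §5 (closure w.r.t. boundary expansion)] -/
def Adm (W : Finset V) (T : Finset U) : Prop :=
  T.card ≤ r ∧ XorSystem.boundary S T ⊆ W

/-- THE CLOSURE of the variable set `W`: the union of all `W`-admissible sets of constraints (for small
`W` on an expander this is the largest `W`-admissible set, `cl_adm`).
[cite: AlekhnovichRazborov2001, §3 (closure of a set of variables)] -/
noncomputable def cl [DecidableEq U] [Fintype U] (W : Finset V) : Finset U :=
  open scoped Classical in (Finset.univ.filter (Adm S r W)).sup id

variable {S r}

/-- Membership in the boundary: `v` lies in exactly one scope of `T`. [folklore] -/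
theorem mem_boundary_iff {T : Finset U} {v : V} :
    v ∈ XorSystem.boundary S T ↔ (T.filter fun u => v ∈ S u).card = 1 := by
  rw [XorSystem.boundary, mem_filter, and_iff_right_iff_imp]
  intro h
  obtain ⟨u, hu⟩ := card_pos.1 (by omega : 0 < (T.filter fun u => v ∈ S u).card)
  exact mem_biUnion.2 ⟨u, (mem_filter.1 hu).1, (mem_filter.1 hu).2⟩

/-- A boundary variable of `T` lies in the scope of some constraint of `T`. [folklore] -/
theorem exists_mem_of_mem_boundary {T : Finset U} {v : V} (h : v ∈ XorSystem.boundary S T) :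
    ∃ u ∈ T, v ∈ S u := by
  obtain ⟨u, hu⟩ := card_pos.1 (by rw [mem_boundary_iff.1 h]; exact Nat.one_pos)
  exact ⟨u, (mem_filter.1 hu).1, (mem_filter.1 hu).2⟩

/-- The boundary of a union lies in the union of the boundaries. [folklore] -/
theorem boundary_union_subset [DecidableEq U] (T₁ T₂ : Finset U) :
    XorSystem.boundary S (T₁ ∪ T₂) ⊆ XorSystem.boundary S T₁ ∪ XorSystem.boundary S T₂ := by
  intro v hv
  have h1 := mem_boundary_iff.1 hv
  obtain ⟨u, hu, hvu⟩ := exists_mem_of_mem_boundary hv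
  have key : ∀ {T : Finset U}, T ⊆ T₁ ∪ T₂ → u ∈ T → v ∈ XorSystem.boundary S T := by
    intro T hT huT
    rw [mem_boundary_iff]
    refine le_antisymm ?_ (card_pos.2 ⟨u, mem_filter.2 ⟨huT, hvu⟩⟩)
    rw [← h1]
    exact card_le_card (filter_subset_filter _ hT)
  rcases mem_union.1 hu with hu | hu
  · exact mem_union.2 (Or.inl (key subset_union_left hu))
  · exact mem_union.2 (Or.inr (key subset_union_right hu))

/-- The empty set of constraints is admissible. [folklore] -/
theorem adm_empty (W : Finset V) : Adm S r W ∅ :=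
  ⟨by simp, by simp [XorSystem.boundary]⟩

/-- Admissibility is monotone in the variable set. [folklore] -/
theorem Adm.mono {W W' : Finset V} (h : W ⊆ W') {T : Finset U} (hT : Adm S r W T) : Adm S r W' T :=
  ⟨hT.1, hT.2.trans h⟩

variable {q e : ℕ}

/-- On a boundary expander (`q|T| ≤ e|∂T|` for `|T| ≤ r`) an admissible set is small:
`q|T| ≤ e|W|`. [cite: BenSassonWigderson2001, §5] -/
theorem Adm.card_le (hexp : ∀ T : Finset U, T.card ≤ r → q * T.card ≤ e * (XorSystem.boundary S T).card)
    {W : Finset V} {T : Finset U} (hT : Adm S r W T) : q * T.card ≤ e * W.card :=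
  (hexp T hT.1).trans (Nat.mul_le_mul_left _ (card_le_card hT.2))

/-- **Admissible sets are closed under union** when `2e|W| ≤ qr`. [cite: BenSassonWigderson2001, §5] -/
theorem Adm.union [DecidableEq U] (hq : 0 < q)
    (hexp : ∀ T : Finset U, T.card ≤ r → q * T.card ≤ e * (XorSystem.boundary S T).card)
    {W : Finset V} (hW : 2 * e * W.card ≤ q * r) {T₁ T₂ : Finset U} (h₁ : Adm S r W T₁)
    (h₂ : Adm S r W T₂) : Adm S r W (T₁ ∪ T₂) := by
  refine ⟨?_, (boundary_union_subset T₁ T₂).trans (union_subset h₁.2 h₂.2)⟩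
  have c₁ := h₁.card_le hexp
  have c₂ := h₂.card_le hexp
  refine Nat.le_of_mul_le_mul_left ?_ hq
  calc q * (T₁ ∪ T₂).card ≤ q * (T₁.card + T₂.card) := Nat.mul_le_mul_left _ (card_union_le _ _)
    _ = q * T₁.card + q * T₂.card := Nat.mul_add _ _ _
    _ ≤ e * W.card + e * W.card := Nat.add_le_add c₁ c₂
    _ = 2 * e * W.card := by ring
    _ ≤ q * r := hW

variable [DecidableEq U] [Fintype U]

/-- An admissible set lies in the closure. [cite: AlekhnovichRazborov2001, §3] -/
theorem subset_cl_of_adm {W : Finset V} {T : Finset U} (hT : Adm S r W T) : T ⊆ cl S r W := by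
  classical
  unfold cl
  have hmem : T ∈ Finset.univ.filter (Adm S r W) := by
    simp only [mem_filter, mem_univ, true_and]; convert hT
  exact Finset.le_sup (f := id) hmem

/-- **The closure is admissible** (for `2e|W| ≤ qr` on an expander): it is the largest `W`-admissible
set. [cite: AlekhnovichRazborov2001, §3] -/
theorem cl_adm (hq : 0 < q)
    (hexp : ∀ T : Finset U, T.card ≤ r → q * T.card ≤ e * (XorSystem.boundary S T).card)
    {W : Finset V} (hW : 2 * e * W.card ≤ q * r) : Adm S r W (cl S r W) := by
  classical
  unfold cl
  have h := Finset.sup_induction (s := Finset.univ.filter (Adm S r W)) (f := id) (p := Adm S r W)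
    (adm_empty W) (fun T₁ h₁ T₂ h₂ => Adm.union hq hexp hW h₁ h₂)
    (fun T hT => by simp only [mem_filter, mem_univ, true_and] at hT; exact hT)
  convert h

/-- The closure of a small set is small: `q|cl W| ≤ e|W|`. [cite: BenSassonWigderson2001, §5] -/
theorem cl_card_le (hq : 0 < q)
    (hexp : ∀ T : Finset U, T.card ≤ r → q * T.card ≤ e * (XorSystem.boundary S T).card)
    {W : Finset V} (hW : 2 * e * W.card ≤ q * r) : q * (cl S r W).card ≤ e * W.card :=
  (cl_adm hq hexp hW).card_le hexp

/-- The closure of a small set has at most `r` constraints. [cite: BenSassonWigderson2001, §5] -/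
theorem cl_card_le_radius (hq : 0 < q)
    (hexp : ∀ T : Finset U, T.card ≤ r → q * T.card ≤ e * (XorSystem.boundary S T).card)
    {W : Finset V} (hW : 2 * e * W.card ≤ q * r) : (cl S r W).card ≤ r :=
  (cl_adm hq hexp hW).1

/-- The boundary of the closure of `W` lies in `W`. [cite: AlekhnovichRazborov2001, §3] -/
theorem boundary_cl_subset (hq : 0 < q)
    (hexp : ∀ T : Finset U, T.card ≤ r → q * T.card ≤ e * (XorSystem.boundary S T).card)
    {W : Finset V} (hW : 2 * e * W.card ≤ q * r) : XorSystem.boundary S (cl S r W) ⊆ W :=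
  (cl_adm hq hexp hW).2

/-- **The closure is monotone** in the variable set. [cite: AlekhnovichRazborov2001, §3] -/
theorem cl_mono {W W' : Finset V} (h : W ⊆ W') : cl S r W ⊆ cl S r W' := by
  classical
  unfold cl
  refine Finset.sup_le fun T hT => ?_
  simp only [mem_filter, mem_univ, true_and] at hT
  have hT' : Adm S r W' T := Adm.mono h (by convert hT)
  have hmem : T ∈ Finset.univ.filter (Adm S r W') := by
    simp only [mem_filter, mem_univ, true_and]; convert hT'
  exact Finset.le_sup (f := id) hmem

/-- A constraint whose scope lies in `W` belongs to the closure of `W` (radius `≥ 1`).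
[cite: AlekhnovichRazborov2001, §3] -/
theorem mem_cl_of_scope_subset (hr : 1 ≤ r) {W : Finset V} {u : U} (hu : S u ⊆ W) :
    u ∈ cl S r W := by
  refine subset_cl_of_adm ⟨by simpa using hr, fun v hv => hu ?_⟩ (mem_singleton_self u)
  obtain ⟨u', hu', hv'⟩ := exists_mem_of_mem_boundary hv
  rwa [mem_singleton.1 hu'] at hv'

/-- On an expander the closure of the empty set is empty (a non-empty set of at most `r` constraints
has a non-empty boundary). [cite: BenSassonWigderson2001, §5] -/
theorem cl_empty (hq : 0 < q)
    (hexp : ∀ T : Finset U, T.card ≤ r → q * T.card ≤ e * (XorSystem.boundary S T).card) :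
    cl S r (∅ : Finset V) = ∅ := by
  have h := cl_card_le hq hexp (W := (∅ : Finset V)) (by simp)
  rw [card_empty, mul_zero] at h
  have : (cl S r (∅ : Finset V)).card = 0 := by
    rcases Nat.eq_zero_or_pos (cl S r (∅ : Finset V)).card with h0 | h0
    · exact h0
    · exact absurd h (by rw [not_le]; exact Nat.mul_pos hq h0)
  exact card_eq_zero.1 this

end Closure

/-! ### The extension lemma -/

section Extend

variable {S : U → Finset V} {b : U → ZMod p} {r q e : ℕ} [DecidableEq U] [Fintype U]

/-- **Peeling step.** For `W` small, a non-empty `T ⊆ cl W'` disjoint from `cl W` (with `cl W ⊆ cl W'`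
of size `≤ r`) contains a constraint `u` with a variable `v ∈ S u` that lies in no other scope of `T`,
not in `W`, and in no scope of `cl W` — for otherwise `T ∪ cl W` would be `W`-admissible, hence inside
`cl W`. [cite: BenSassonWigderson2001, §5 (peeling argument)] -/
theorem exists_private (hq : 0 < q)
    (hexp : ∀ T : Finset U, T.card ≤ r → q * T.card ≤ e * (XorSystem.boundary S T).card)
    {W W' : Finset V} (hWW' : W ⊆ W') (hW' : 2 * e * W'.card ≤ q * r) {T : Finset U}
    (hT : T ⊆ cl S r W') (hdisj : Disjoint T (cl S r W)) (hne : T.Nonempty) :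
    ∃ u ∈ T, ∃ v ∈ S u, (T.filter fun u' => v ∈ S u').card = 1 ∧ v ∉ W ∧
      v ∉ (cl S r W).biUnion S := by
  classical
  have hW : 2 * e * W.card ≤ q * r :=
    le_trans (Nat.mul_le_mul_left _ (card_le_card hWW')) hW'
  by_contra hcon
  have hcon' : ∀ u ∈ T, ∀ v ∈ S u, (T.filter fun u' => v ∈ S u').card = 1 →
      v ∈ W ∨ v ∈ (cl S r W).biUnion S := by
    intro u hu v hv h1
    by_contra h'
    exact hcon ⟨u, hu, v, hv, h1, fun hW => h' (Or.inl hW), fun hN => h' (Or.inr hN)⟩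
  -- `T ∪ cl W` is `W`-admissible
  have hadm : Adm S r W (T ∪ cl S r W) := by
    refine ⟨?_, fun v hv => ?_⟩
    · calc (T ∪ cl S r W).card ≤ (cl S r W').card :=
            card_le_card (union_subset hT (cl_mono hWW'))
        _ ≤ r := cl_card_le_radius hq hexp hW'
    · have h1 := mem_boundary_iff.1 hv
      rw [filter_union, card_union_of_disjoint
        (disjoint_filter_filter hdisj)] at h1
      rcases Nat.eq_zero_or_pos (T.filter fun u' => v ∈ S u').card with hT0 | hTpos
      · -- the unique scope is in `cl W`: `v ∈ ∂(cl W) ⊆ W`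
        rw [hT0, zero_add] at h1
        exact boundary_cl_subset hq hexp hW (mem_boundary_iff.2 h1)
      · have hT1 : (T.filter fun u' => v ∈ S u').card = 1 := by omega
        have hC0 : ((cl S r W).filter fun u' => v ∈ S u').card = 0 := by omega
        obtain ⟨u, hu⟩ := card_pos.1 hTpos
        rw [mem_filter] at hu
        rcases hcon' u hu.1 v hu.2 hT1 with hvW | hvN
        · exact hvW
        · exfalso
          obtain ⟨u', hu', hvu'⟩ := mem_biUnion.1 hvN
          rw [card_eq_zero] at hC0
          exact notMem_empty u' (hC0 ▸ mem_filter.2 ⟨hu', hvu'⟩)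
  have hsub : T ⊆ cl S r W := subset_union_left.trans (subset_cl_of_adm hadm)
  obtain ⟨u, hu⟩ := hne
  exact disjoint_left.1 hdisj hu (hsub hu)

/-- **The extension lemma.** On a boundary expander, for `W ⊆ W'` with `2e|W'| ≤ qr`: every assignment
satisfying the constraints of `cl W` agrees on `W` and on the variables of `cl W` with an assignment
satisfying the constraints of `cl W'`.  (Induction on a set `T ⊆ cl W' ∖ cl W` of constraints still to
be satisfied, peeling a constraint with a private variable and solving for that variable.)
[cite: BenSassonWigderson2001, §5; BenabbasEtAl2012, §4.1 (Lemma: solutions of the closure extend)] -/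
theorem exists_extend (hq : 0 < q)
    (hexp : ∀ T : Finset U, T.card ≤ r → q * T.card ≤ e * (XorSystem.boundary S T).card)
    {W W' : Finset V} (hWW' : W ⊆ W') (hW' : 2 * e * W'.card ≤ q * r) {x : V → ZMod p}
    (hx : ∀ u ∈ cl S r W, Sat S b x u) :
    ∃ x' : V → ZMod p, (∀ u ∈ cl S r W', Sat S b x' u) ∧
      ∀ v, (v ∈ W ∨ v ∈ (cl S r W).biUnion S) → x' v = x v := by
  classical
  -- claim for every `T ⊆ cl W'` disjoint from `cl W`, by induction on `|T|`
  suffices key : ∀ (n : ℕ) (T : Finset U), T.card = n → T ⊆ cl S r W' → Disjoint T (cl S r W) →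
      ∃ x' : V → ZMod p, (∀ u ∈ cl S r W ∪ T, Sat S b x' u) ∧
        ∀ v, (v ∈ W ∨ v ∈ (cl S r W).biUnion S) → x' v = x v by
    have hcl : cl S r W ⊆ cl S r W' := cl_mono hWW'
    obtain ⟨x', hx', hagree⟩ := key _ (cl S r W' \ cl S r W) rfl sdiff_subset sdiff_disjoint
    refine ⟨x', fun u hu => hx' u ?_, hagree⟩
    rw [union_sdiff_of_subset hcl]
    exact hu
  intro n
  induction n with
  | zero =>
    intro T hT _ _
    rw [card_eq_zero] at hT
    subst hT
    exact ⟨x, by simpa using hx, fun _ _ => rfl⟩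
  | succ n ih =>
    intro T hTcard hT hdisj
    have hne : T.Nonempty := card_pos.1 (by omega)
    obtain ⟨u, hu, v, hvu, h1, hvW, hvN⟩ := exists_private hq hexp hWW' hW' hT hdisj hne
    obtain ⟨x₁, hx₁, hagree₁⟩ := ih (T.erase u) (by rw [card_erase_of_mem hu, hTcard]; rfl)
      ((erase_subset u T).trans hT) (disjoint_of_subset_left (erase_subset u T) hdisj)
    -- solve constraint `u` for its private variable `v`
    let a : ZMod p := b u - ∑ w ∈ (S u).erase v, x₁ w
    refine ⟨Function.update x₁ v a, fun u' hu' => ?_, fun w hw => ?_⟩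
    · by_cases huu' : u' = u
      · subst huu'
        show ∑ w ∈ S u', Function.update x₁ v a w = b u'
        rw [← insert_erase hvu, sum_insert (notMem_erase v _), Function.update_self]
        have : ∑ w ∈ (S u').erase v, Function.update x₁ v a w = ∑ w ∈ (S u').erase v, x₁ w :=
          sum_congr rfl fun w hw => Function.update_of_ne (ne_of_mem_erase hw) _ _
        rw [this]
        exact sub_add_cancel _ _
      · -- `v ∉ S u'`, so the constraint is untouched
        have hu'mem : u' ∈ cl S r W ∪ T.erase u := by
          rcases mem_union.1 hu' with h | h
          · exact mem_union.2 (Or.inl h)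
          · exact mem_union.2 (Or.inr (mem_erase.2 ⟨huu', h⟩))
        have hvS : v ∉ S u' := by
          intro hv'
          rcases mem_union.1 hu' with h | h
          · exact hvN (mem_biUnion.2 ⟨u', h, hv'⟩)
          · -- both `u` and `u'` are in the filter of cardinality one
            have h2 : ({u, u'} : Finset U) ⊆ T.filter fun u'' => v ∈ S u'' := by
              intro w hw
              rcases mem_insert.1 hw with rfl | hw
              · exact mem_filter.2 ⟨hu, hvu⟩
              · rw [mem_singleton.1 hw]; exact mem_filter.2 ⟨h, hv'⟩
            have := card_le_card h2
            rw [h1, card_pair (Ne.symm huu')] at this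
            omega
        show ∑ w ∈ S u', Function.update x₁ v a w = b u'
        rw [sum_congr rfl fun w hw => Function.update_of_ne (ne_of_mem_of_not_mem hw hvS) _ _]
        exact hx₁ u' hu'mem
    · rw [← hagree₁ w hw]
      refine Function.update_of_ne ?_ _ _
      rintro rfl
      rcases hw with hw | hw
      · exact hvW hw
      · exact hvN hw

end Extend

/-! ### Consistent (good) partial assignments -/

section Good

variable (S : U → Finset V) (b : U → ZMod p) (r : ℕ) [DecidableEq U] [Fintype U]

/-- The partial assignment `h|W` is CONSISTENT ("good"): it is the restriction to `W` of an assignment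
satisfying every constraint of the closure `cl W`.  (For `p = 2` and the same closure radius this is
Duplicator's winning region of Atserias–Dawar 2019, Lemma 3.5; cf. `XorSystem.Good`.)
[cite: BenabbasEtAl2012, §4.1] -/
def Good (W : Finset V) (h : V → ZMod p) : Prop :=
  ∃ x : V → ZMod p, (∀ u ∈ cl S r W, Sat S b x u) ∧ ∀ v ∈ W, x v = h v

variable {S b r} {q e : ℕ}

/-- Consistency is preserved under shrinking the domain. [folklore] -/
theorem Good.mono {W W' : Finset V} (hW : W' ⊆ W) {h : V → ZMod p} (hg : Good S b r W h) :
    Good S b r W' h := by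
  obtain ⟨x, hx, hxh⟩ := hg
  exact ⟨x, fun u hu => hx u (cl_mono hW hu), fun v hv => hxh v (hW hv)⟩

/-- Consistency depends only on the values on the domain. [folklore] -/
theorem Good.congr {W : Finset V} {h g : V → ZMod p} (hg : Good S b r W h)
    (hfg : ∀ v ∈ W, h v = g v) : Good S b r W g := by
  obtain ⟨x, hx, hxh⟩ := hg
  exact ⟨x, hx, fun v hv => (hxh v hv).trans (hfg v hv)⟩

/-- **A good assignment satisfies every constraint whose scope lies in its domain** (radius `≥ 1`).
[cite: AtseriasDawar2019, Lemma 3.2 (proof)] -/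
theorem Good.sum_eq (hr : 1 ≤ r) {W : Finset V} {h : V → ZMod p} (hg : Good S b r W h) {u : U}
    (hu : S u ⊆ W) : ∑ v ∈ S u, h v = b u := by
  obtain ⟨x, hx, hxh⟩ := hg
  rw [← sum_congr rfl fun v hv => hxh v (hu hv)]
  exact hx u (mem_cl_of_scope_subset hr hu)

/-- **On an expander every assignment is good on the empty domain** (the closure of `∅` is empty).
[cite: AtseriasDawar2019, Claim 3.6] -/
theorem good_of_empty (hq : 0 < q)
    (hexp : ∀ T : Finset U, T.card ≤ r → q * T.card ≤ e * (XorSystem.boundary S T).card)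
    (h : V → ZMod p) : Good S b r ∅ h :=
  ⟨h, fun u hu => by rw [cl_empty hq hexp] at hu; exact absurd hu (notMem_empty u),
    fun _ h => absurd h (notMem_empty _)⟩

/-- **Good assignments extend** (Atserias–Dawar 2019, Lemma 3.5 / Claim 3.7, for `ℤ/p` and whole
target domains at once): on a boundary expander, a good assignment on `W ⊆ W'` with `2e|W'| ≤ qr`
agrees on `W` with a good assignment on `W'`. [cite: AtseriasDawar2019, Lemma 3.5] -/
theorem Good.extend (hq : 0 < q)
    (hexp : ∀ T : Finset U, T.card ≤ r → q * T.card ≤ e * (XorSystem.boundary S T).card)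
    {W W' : Finset V} (hWW' : W ⊆ W') (hW' : 2 * e * W'.card ≤ q * r) {h : V → ZMod p}
    (hg : Good S b r W h) : ∃ g : V → ZMod p, Good S b r W' g ∧ ∀ v ∈ W, g v = h v := by
  obtain ⟨x, hx, hxh⟩ := hg
  obtain ⟨x', hx', hagree⟩ := exists_extend hq hexp hWW' hW' hx
  exact ⟨x', ⟨x', hx', fun _ _ => rfl⟩, fun v hv => (hagree v (Or.inl hv)).trans (hxh v hv)⟩

end Good

/-! ### Local distributions conditioned on a good assignment -/

section Measure

variable (S : U → Finset V) (b : U → ZMod p) (r : ℕ) [DecidableEq U] [Fintype U] [Fintype V]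
  [NeZero p]

/-- The solutions of the constraints of `cl (W ∪ D)` that extend `h|W`. [cite: BenabbasEtAl2012, §4.1] -/
noncomputable def solSet (W : Finset V) (h : V → ZMod p) (D : Finset V) : Finset (V → ZMod p) :=
  open scoped Classical in
  Finset.univ.filter fun x => (∀ u ∈ cl S r (W ∪ D), Sat S b x u) ∧ ∀ v ∈ W, x v = h v

/-- `imgSet W h D`: the restrictions to `D` of the solutions of `cl (W ∪ D)` extending `h|W` — the
support of the local distribution on the context `D` conditioned on `h`.
[cite: BenabbasEtAl2012, §4.1] -/
noncomputable def imgSet (W : Finset V) (h : V → ZMod p) (D : Finset V) : Finset (↥D → ZMod p) :=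
  (solSet S b r W h D).image D.restrict

/-- THE LOCAL DISTRIBUTION on the context `D` conditioned on `h|W`: the uniform probability measure on
`imgSet W h D`, as a `ℚ`-valued function on sections over `D` (zero outside).
[cite: BenabbasEtAl2012, §4.1; LichterPago2025, Cor. 4.13 (p-solutions with a fixed local assignment)] -/
noncomputable def locMeasure (W : Finset V) (h : V → ZMod p) (D : Finset V) (t : ↥D → ZMod p) : ℚ :=
  if t ∈ imgSet S b r W h D then ((imgSet S b r W h D).card : ℚ)⁻¹ else 0

variable {S b r} {q e : ℕ}

/-- Unfolding membership in `solSet`. [folklore] -/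
theorem mem_solSet {W D : Finset V} {h x : V → ZMod p} :
    x ∈ solSet S b r W h D ↔ (∀ u ∈ cl S r (W ∪ D), Sat S b x u) ∧ ∀ v ∈ W, x v = h v := by
  classical
  unfold solSet
  simp only [Finset.mem_filter, Finset.mem_univ, true_and]

/-- Unfolding membership in `imgSet`. [folklore] -/
theorem mem_imgSet {W D : Finset V} {h : V → ZMod p} {t : ↥D → ZMod p} :
    t ∈ imgSet S b r W h D ↔ ∃ x ∈ solSet S b r W h D, D.restrict x = t := by
  unfold imgSet
  rw [Finset.mem_image]

/-- `solSet` is closed under the Mal'cev operation `x₁ - x₂ + x₃` (solution sets of linear systems are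
affine). [folklore] -/
theorem sub_add_mem_solSet {W D : Finset V} {h : V → ZMod p} {x₁ x₂ x₃ : V → ZMod p}
    (h₁ : x₁ ∈ solSet S b r W h D) (h₂ : x₂ ∈ solSet S b r W h D) (h₃ : x₃ ∈ solSet S b r W h D) :
    x₁ - x₂ + x₃ ∈ solSet S b r W h D := by
  rw [mem_solSet] at h₁ h₂ h₃ ⊢
  refine ⟨fun u hu => ?_, fun v hv => ?_⟩
  · have e₁ := h₁.1 u hu
    have e₂ := h₂.1 u hu
    have e₃ := h₃.1 u hu
    unfold Sat at e₁ e₂ e₃ ⊢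
    simp only [Pi.add_apply, Pi.sub_apply, Finset.sum_add_distrib, Finset.sum_sub_distrib, e₁, e₂, e₃,
      sub_self, zero_add]
  · simp only [Pi.add_apply, Pi.sub_apply, h₁.2 v hv, h₂.2 v hv, h₃.2 v hv, sub_self, zero_add]

/-- `imgSet` is closed under the Mal'cev operation `t₁ - t₂ + t₃`. [folklore] -/
theorem sub_add_mem_imgSet {W D : Finset V} {h : V → ZMod p} {t₁ t₂ t₃ : ↥D → ZMod p}
    (h₁ : t₁ ∈ imgSet S b r W h D) (h₂ : t₂ ∈ imgSet S b r W h D) (h₃ : t₃ ∈ imgSet S b r W h D) :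
    t₁ - t₂ + t₃ ∈ imgSet S b r W h D := by
  rw [mem_imgSet] at h₁ h₂ h₃ ⊢
  obtain ⟨x₁, hx₁, rfl⟩ := h₁
  obtain ⟨x₂, hx₂, rfl⟩ := h₂
  obtain ⟨x₃, hx₃, rfl⟩ := h₃
  exact ⟨x₁ - x₂ + x₃, sub_add_mem_solSet hx₁ hx₂ hx₃, rfl⟩

/-- Shrinking the context enlarges the solution set (`cl` is monotone). [folklore] -/
theorem solSet_subset_solSet {W D D' : Finset V} (hD : D' ⊆ D) {h : V → ZMod p} :
    solSet S b r W h D ⊆ solSet S b r W h D' := by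
  intro x hx
  rw [mem_solSet] at hx ⊢
  exact ⟨fun u hu => hx.1 u (cl_mono (union_subset_union le_rfl hD) hu), hx.2⟩

/-- **Image equality.** For a good `h` and `2e|W ∪ D| ≤ qr`, restricting `imgSet D` to `D' ⊆ D` gives
exactly `imgSet D'` (surjectivity is the extension lemma). [cite: BenabbasEtAl2012, §4.1] -/
theorem image_restrict₂_imgSet (hq : 0 < q)
    (hexp : ∀ T : Finset U, T.card ≤ r → q * T.card ≤ e * (XorSystem.boundary S T).card)
    {W D D' : Finset V} (hD : D' ⊆ D) (hWD : 2 * e * (W ∪ D).card ≤ q * r) {h : V → ZMod p} :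
    (imgSet S b r W h D).image (Finset.restrict₂ (π := fun _ => ZMod p) hD) = imgSet S b r W h D' := by
  classical
  ext t'
  rw [Finset.mem_image, mem_imgSet]
  constructor
  · rintro ⟨t, ht, rfl⟩
    obtain ⟨x, hx, rfl⟩ := mem_imgSet.1 ht
    exact ⟨x, solSet_subset_solSet hD hx, rfl⟩
  · rintro ⟨y, hy, rfl⟩
    rw [mem_solSet] at hy
    obtain ⟨y', hy', hagree⟩ := exists_extend (b := b) hq hexp
      (union_subset_union (le_refl W) hD) hWD hy.1
    refine ⟨D.restrict y', mem_imgSet.2 ⟨y', mem_solSet.2 ⟨hy', fun v hv => ?_⟩, rfl⟩, ?_⟩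
    · rw [hagree v (Or.inl (mem_union_left _ hv))]
      exact hy.2 v hv
    · funext d
      exact hagree d (Or.inl (mem_union_right _ d.2))

/-- `imgSet` is non-empty for a good `h` (and `2e|W ∪ D| ≤ qr`). [cite: BenabbasEtAl2012, §4.1] -/
theorem imgSet_nonempty (hq : 0 < q)
    (hexp : ∀ T : Finset U, T.card ≤ r → q * T.card ≤ e * (XorSystem.boundary S T).card)
    {W D : Finset V} (hWD : 2 * e * (W ∪ D).card ≤ q * r) {h : V → ZMod p} (hg : Good S b r W h) :
    (imgSet S b r W h D).Nonempty := by
  obtain ⟨g, ⟨x, hx, hxg⟩, hgh⟩ := hg.extend hq hexp subset_union_left hWD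
  refine ⟨D.restrict x, mem_imgSet.2 ⟨x, mem_solSet.2 ⟨hx, fun v hv => ?_⟩, rfl⟩⟩
  rw [hxg v (mem_union_left _ hv)]
  exact hgh v hv

/-- **Total mass one.** [cite: BenabbasEtAl2012, §4.1] -/
theorem sum_locMeasure (hq : 0 < q)
    (hexp : ∀ T : Finset U, T.card ≤ r → q * T.card ≤ e * (XorSystem.boundary S T).card)
    {W D : Finset V} (hWD : 2 * e * (W ∪ D).card ≤ q * r) {h : V → ZMod p} (hg : Good S b r W h) :
    ∑ t, locMeasure S b r W h D t = 1 := by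
  classical
  have hne := imgSet_nonempty hq hexp hWD hg (D := D)
  unfold locMeasure
  rw [Finset.sum_ite_mem, Finset.univ_inter, Finset.sum_const, nsmul_eq_mul]
  exact mul_inv_cancel₀ (by exact_mod_cast hne.card_pos.ne')

/-- The local distribution is non-negative. [folklore] -/
theorem locMeasure_nonneg {W D : Finset V} {h : V → ZMod p} (t : ↥D → ZMod p) :
    0 ≤ locMeasure S b r W h D t := by
  unfold locMeasure
  split_ifs
  · positivity
  · exact le_rfl

/-- **Support.** A section of non-zero measure is the restriction of a solution of `cl (W ∪ D)`
extending `h|W`; in particular it is good on `W ∪ D` (hence on `D`) together with `h`.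
[cite: BenabbasEtAl2012, §4.1] -/
theorem exists_of_locMeasure_ne_zero {W D : Finset V} {h : V → ZMod p} {t : ↥D → ZMod p}
    (ht : locMeasure S b r W h D t ≠ 0) :
    ∃ x : V → ZMod p, Good S b r (W ∪ D) x ∧ (∀ v ∈ W, x v = h v) ∧ ∀ d : ↥D, x d = t d := by
  unfold locMeasure at ht
  split_ifs at ht with hmem
  · obtain ⟨x, hx, rfl⟩ := mem_imgSet.1 hmem
    rw [mem_solSet] at hx
    exact ⟨x, ⟨x, hx.1, fun _ _ => rfl⟩, hx.2, fun _ => rfl⟩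
  · exact absurd rfl ht

/-- On a context every section of non-zero measure extends `h|W` where defined. [folklore] -/
theorem eq_of_locMeasure_ne_zero {W D : Finset V} {h : V → ZMod p} {t : ↥D → ZMod p}
    (ht : locMeasure S b r W h D t ≠ 0) (d : ↥D) (hd : (d : V) ∈ W) : t d = h d := by
  obtain ⟨x, -, hxh, hxt⟩ := exists_of_locMeasure_ne_zero ht
  rw [← hxt d]
  exact hxh d hd

/-- **Compatibility under restriction of contexts.** For a good `h`, `D' ⊆ D` and `2e|W ∪ D| ≤ qr`,
the push-forward of the local distribution on `D` along restriction to `D'` is the local distribution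
on `D'`: `∑_{t|D' = t'} μ_D(t) = μ_{D'}(t')`.  (Image equality by the extension lemma; all fibres of
the restriction map on `imgSet D` have the same size since `imgSet D` is closed under `t₁ - t₂ + t₃`.)
[cite: BenabbasEtAl2012, §4.1 (consistency of the local distributions); LichterPago2025, Lemma 4.7] -/
theorem sum_locMeasure_restrict (hq : 0 < q)
    (hexp : ∀ T : Finset U, T.card ≤ r → q * T.card ≤ e * (XorSystem.boundary S T).card)
    {W D D' : Finset V} (hD : D' ⊆ D) (hWD : 2 * e * (W ∪ D).card ≤ q * r) {h : V → ZMod p}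
    (t' : ↥D' → ZMod p) :
    ∑ t, (if Finset.restrict₂ (π := fun _ => ZMod p) hD t = t' then locMeasure S b r W h D t else 0) =
      locMeasure S b r W h D' t' := by
  classical
  set img := imgSet S b r W h D with himg
  set img' := imgSet S b r W h D' with himg'
  have himage : img.image (Finset.restrict₂ (π := fun _ => ZMod p) hD) = img' := image_restrict₂_imgSet hq hexp hD hWD
  -- the fibre of `a` inside `img`
  set fib : (↥D' → ZMod p) → Finset (↥D → ZMod p) := fun a => img.filter fun t => Finset.restrict₂ (π := fun _ => ZMod p) hD t = a
    with hfib
  -- all non-empty fibres have the same size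
  have hfibeq : ∀ a₁ ∈ img', ∀ a₂ ∈ img', (fib a₁).card ≤ (fib a₂).card := by
    intro a₁ ha₁ a₂ ha₂
    rw [← himage, Finset.mem_image] at ha₁ ha₂
    obtain ⟨s₁, hs₁, rfl⟩ := ha₁
    obtain ⟨s₂, hs₂, rfl⟩ := ha₂
    refine Finset.card_le_card_of_injOn (fun t => t - s₁ + s₂) (fun t ht => ?_) ?_
    · rw [Finset.mem_coe, hfib, Finset.mem_filter] at ht ⊢
      refine ⟨sub_add_mem_imgSet ht.1 hs₁ hs₂, ?_⟩
      funext d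
      have := congr_fun ht.2 d
      simp only [Finset.restrict₂, Pi.add_apply, Pi.sub_apply] at this ⊢
      rw [this, sub_self, zero_add]
    · intro t₁ _ t₂ _ h12
      simpa using h12
  have hfibeq' : ∀ a₁ ∈ img', ∀ a₂ ∈ img', (fib a₁).card = (fib a₂).card := fun a₁ h₁ a₂ h₂ =>
    le_antisymm (hfibeq a₁ h₁ a₂ h₂) (hfibeq a₂ h₂ a₁ h₁)
  -- `|img| = Σ_{a ∈ img'} |fib a|`
  have hcard : img.card = ∑ a ∈ img', (fib a).card := by
    refine Finset.card_eq_sum_card_fiberwise fun t ht => ?_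
    rw [← himage]
    exact Finset.mem_image_of_mem _ ht
  -- the left-hand side is `|fib t'| / |img|`
  have hlhs : ∑ t, (if Finset.restrict₂ (π := fun _ => ZMod p) hD t = t' then locMeasure S b r W h D t else 0) =
      (fib t').card * ((img.card : ℚ)⁻¹) := by
    rw [Finset.card_eq_sum_ones, Nat.cast_sum, Finset.sum_mul, hfib, Finset.sum_filter,
      ← Finset.sum_subset (Finset.subset_univ img)]
    · refine Finset.sum_congr rfl fun t ht => ?_
      unfold locMeasure
      rw [← himg]
      by_cases h1 : Finset.restrict₂ (π := fun _ => ZMod p) hD t = t' <;> simp [h1, ht]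
    · intro t _ ht
      unfold locMeasure
      rw [← himg]
      simp [ht]
  rw [hlhs]
  by_cases ht' : t' ∈ img'
  · -- `|img| = |img'| · |fib t'|`
    have hmul : img.card = img'.card * (fib t').card := by
      rw [hcard, Finset.sum_const_nat fun a ha => hfibeq' a ha t' ht', Finset.card_eq_sum_ones img',
        Finset.sum_mul, one_mul]
    have hpos : 0 < (fib t').card := by
      rw [← himage, Finset.mem_image] at ht'
      obtain ⟨t, ht, htt'⟩ := ht'
      exact Finset.card_pos.2 ⟨t, by rw [hfib, Finset.mem_filter]; exact ⟨ht, htt'⟩⟩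
    unfold locMeasure
    rw [← himg', if_pos ht', hmul, Nat.cast_mul, mul_inv, ← mul_assoc, mul_comm ((fib t').card : ℚ),
      mul_assoc, mul_inv_cancel₀ (by exact_mod_cast hpos.ne'), mul_one]
  · have h0 : (fib t').card = 0 := by
      rw [Finset.card_eq_zero, hfib, Finset.filter_eq_empty_iff]
      intro t ht htt'
      exact ht' (himage ▸ Finset.mem_image.2 ⟨t, ht, htt'⟩)
    unfold locMeasure
    rw [← himg', if_neg ht', h0, Nat.cast_zero, zero_mul]

/-- On the context `W` itself the local distribution conditioned on `h|W` is the point mass at `h|W`.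
[folklore] -/
theorem locMeasure_self (hq : 0 < q)
    (hexp : ∀ T : Finset U, T.card ≤ r → q * T.card ≤ e * (XorSystem.boundary S T).card)
    {W : Finset V} (hW : 2 * e * W.card ≤ q * r) {h : V → ZMod p} (hg : Good S b r W h)
    (t : ↥W → ZMod p) : locMeasure S b r W h W t = if t = W.restrict h then 1 else 0 := by
  classical
  have hWW : 2 * e * (W ∪ W).card ≤ q * r := by rwa [Finset.union_idempotent]
  have himg : imgSet S b r W h W = {W.restrict h} := by
    refine Finset.eq_singleton_iff_unique_mem.2 ⟨?_, fun t ht => ?_⟩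
    · obtain ⟨t, ht⟩ := imgSet_nonempty hq hexp hWW hg (D := W)
      obtain ⟨x, hx, rfl⟩ := mem_imgSet.1 ht
      have : W.restrict x = W.restrict h := funext fun d => (mem_solSet.1 hx).2 d d.2
      rw [← this]; exact ht
    · obtain ⟨x, hx, rfl⟩ := mem_imgSet.1 ht
      exact funext fun d => (mem_solSet.1 hx).2 d d.2
  simp only [locMeasure, himg, Finset.mem_singleton, Finset.card_singleton, Nat.cast_one, inv_one]

/-- **`p`-power denominators** (`p` prime): all non-zero values of the local distribution on `D` equal
one and the same `(p^j)⁻¹` with `j ≤ |D|` — `imgSet D` is a coset of a subgroup of the `p`-group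
`(↥D → ZMod p)` (it is closed under `t₁ - t₂ + t₃`), so its size is a power of `p` (Lagrange).  This is
the `p`-solution property of Berkholz–Grohe / Lichter–Pago, Def. 2.1. [cite: LichterPago2025, Def. 2.1 and Cor. 4.13] -/
theorem locMeasure_eq_inv_pow [Fact p.Prime] {W D : Finset V} {h : V → ZMod p} :
    ∃ j : ℕ, j ≤ D.card ∧ ∀ t, locMeasure S b r W h D t = 0 ∨
      locMeasure S b r W h D t = ((p : ℚ) ^ j)⁻¹ := by
  classical
  set img := imgSet S b r W h D with himg
  rcases img.eq_empty_or_nonempty with h0 | ⟨t₀, ht₀⟩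
  · refine ⟨0, Nat.zero_le _, fun t => Or.inl ?_⟩
    unfold locMeasure
    rw [← himg, h0]
    simp
  · -- the subgroup `H = img - t₀`
    let H : AddSubgroup (↥D → ZMod p) :=
      { carrier := {d | t₀ + d ∈ img}
        zero_mem' := by simpa using ht₀
        add_mem' := by
          intro d₁ d₂ hd₁ hd₂
          have := sub_add_mem_imgSet hd₁ ht₀ hd₂
          show t₀ + (d₁ + d₂) ∈ img
          convert this using 1
          abel
        neg_mem' := by
          intro d hd
          have := sub_add_mem_imgSet ht₀ hd ht₀
          show t₀ + -d ∈ img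
          convert this using 1
          abel }
    have hHcard : Nat.card H = img.card := by
      have e1 : Nat.card H = Nat.card {d : ↥D → ZMod p // t₀ + d ∈ img} :=
        Nat.card_congr (Equiv.subtypeEquivRight fun d => Iff.rfl)
      rw [e1, Nat.card_eq_fintype_card, Fintype.card_subtype]
      refine Finset.card_nbij' (fun d => t₀ + d) (fun t => t - t₀) (fun d hd => ?_) (fun t ht => ?_)
        (fun d _ => add_sub_cancel_left t₀ d) (fun t _ => add_sub_cancel t₀ t)
      · simpa using hd
      · rw [Finset.mem_coe] at ht
        simp only [Finset.mem_coe, Finset.mem_filter, Finset.mem_univ, true_and, add_sub_cancel]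
        exact ht
    have hG : Nat.card (↥D → ZMod p) = p ^ D.card := by
      rw [Nat.card_eq_fintype_card, Fintype.card_fun, ZMod.card, Fintype.card_coe]
    have hdvd : img.card ∣ p ^ D.card := by
      rw [← hHcard, ← hG]
      exact AddSubgroup.card_addSubgroup_dvd_card H
    obtain ⟨j, hj, hjeq⟩ := (Nat.dvd_prime_pow (Fact.out : p.Prime)).1 hdvd
    refine ⟨j, hj, fun t => ?_⟩
    unfold locMeasure
    rw [← himg]
    split_ifs
    · right
      rw [hjeq, Nat.cast_pow]
    · exact Or.inl rfl

/-- **Integrality after scaling by `p^|D|`** (the form used to combine a `2`-adic and a `3`-adic family):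
`p^{|D|} · μ_D(t)` is a natural number. [cite: LichterPago2025, Lemma 2.2 (p- and q-solutions combine to an integral one)] -/
theorem exists_nat_eq_pow_mul_locMeasure [Fact p.Prime] {W D : Finset V} {h : V → ZMod p}
    (t : ↥D → ZMod p) : ∃ z : ℕ, (z : ℚ) = (p : ℚ) ^ D.card * locMeasure S b r W h D t := by
  obtain ⟨j, hj, hval⟩ := locMeasure_eq_inv_pow (S := S) (b := b) (r := r) (W := W) (D := D) (h := h)
  rcases hval t with h0 | h1
  · exact ⟨0, by rw [h0, mul_zero, Nat.cast_zero]⟩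
  · refine ⟨p ^ (D.card - j), ?_⟩
    have hp : (p : ℚ) ≠ 0 := by exact_mod_cast (Fact.out : p.Prime).ne_zero
    rw [h1, Nat.cast_pow, ← Nat.sub_add_cancel hj, pow_add, mul_assoc, mul_inv_cancel₀ (pow_ne_zero _ hp),
      mul_one, Nat.add_sub_cancel]

end Measure

end LinSystem

end Literature.ModelTheory.FiniteModelTheory
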